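import Literature.Algebra.Homology.NatCochainLongExactSequence
import Literature.Algebra.Homology.EulerInequalityGrowth
import HarnessLib

/-!
# The six-term dimension inequality of a short exact sequence of cochain complexes

For a short exact sequence `0 → A → B → C → 0` of `ℕ`-indexed cochain complexes of vector spaces
(`NatCochain.ShortExactSeq`, file `NatCochainLongExactSequence`) whose cohomology is
finite-dimensional in degrees `0` and `1`, the first six terms
`0 → H⁰(A) → H⁰(B) → H⁰(C) → H¹(A) → H¹(B) → H¹(C)` of the long exact sequence give, by
rank–nullity (`finrank_six_term_le`, file `EulerInequalityGrowth`),

  `h⁰(A) + h⁰(C) + h¹(B) ≤ h⁰(B) + h¹(A) + h¹(C)`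

(`ShortExactSeq.finrank_six_term_le`). Applied to the Čech complexes of
`0 → 𝒪(L𝓗ᵐ) →ᵗ 𝒪(L𝓗ᵐ⁺¹) → 𝓠_{m+1} → 0` (restriction to a hyperplane section `t = 0`) this is
the inequality `hstep` consumed by `eventually_pos_euler_of_inequalities` /
`exists_pos_h0_of_euler_inequalities` — the dimension count of Serre's theorem A for line bundles
(J.-P. Serre, *GAGA* (1956), n° 16 Lemme 8), with no vanishing theorem and no duality.

## References

* J.-P. Serre, *Géométrie algébrique et géométrie analytique*, Ann. Inst. Fourier 6 (1956), n° 16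
  Lemme 8. [SerreGAGA1956]
* C. A. Weibel, *An Introduction to Homological Algebra* (1994), Thm. 1.3.1. [Weibel1994]
-/

namespace Literature.Algebra.Homology

universe u w w' w''

open Function Module

namespace NatCochain.ShortExactSeq

variable {K : Type u} [Field K]
  {A : ℕ → Type w} [∀ n, AddCommGroup (A n)] [∀ n, Module K (A n)]
  {B : ℕ → Type w'} [∀ n, AddCommGroup (B n)] [∀ n, Module K (B n)]
  {C : ℕ → Type w''} [∀ n, AddCommGroup (C n)] [∀ n, Module K (C n)]
  {dA : ∀ n, A n →ₗ[K] A (n + 1)} {dB : ∀ n, B n →ₗ[K] B (n + 1)}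
  {dC : ∀ n, C n →ₗ[K] C (n + 1)}

/-- **The six-term dimension inequality** of a short exact sequence of cochain complexes of
vector spaces with finite-dimensional `H⁰(B), H⁰(C), H¹(A), H¹(B), H¹(C)`:
`h⁰(A) + h⁰(C) + h¹(B) ≤ h⁰(B) + h¹(A) + h¹(C)` — rank–nullity along
`0 → H⁰(A) → H⁰(B) → H⁰(C) → H¹(A) → H¹(B) → H¹(C)` (`injective_map_zero`, `exact_map_map`,
`exact_map_delta`, `exact_delta_map`). Equivalently `χ(B) ≥ χ(A) + χ(C)` for the truncated Euler
characteristics `χ = h⁰ - h¹`. [cite: SerreGAGA1956, n° 16 Lemme 8 (dimension count)] -/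
theorem finrank_six_term_le (S : ShortExactSeq dA dB dC)
    [FiniteDimensional K (Cohomology dB 0)] [FiniteDimensional K (Cohomology dC 0)]
    [FiniteDimensional K (Cohomology dA 1)] [FiniteDimensional K (Cohomology dB 1)]
    [FiniteDimensional K (Cohomology dC 1)] :
    finrank K (Cohomology dA 0) + finrank K (Cohomology dC 0) + finrank K (Cohomology dB 1) ≤
      finrank K (Cohomology dB 0) + finrank K (Cohomology dA 1) + finrank K (Cohomology dC 1) :=
  Literature.Algebra.Homology.finrank_six_term_le (Cohomology.map S.f S.comm_f 0)
    (Cohomology.map S.g S.comm_g 0) (S.delta 0) (Cohomology.map S.f S.comm_f 1)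
    (Cohomology.map S.g S.comm_g 1) S.injective_map_zero (S.exact_map_map 0) (S.exact_map_delta 0)
    (S.exact_delta_map 0) (S.exact_map_map 1)

/-- **The six-term inequality in Euler-characteristic form**: `χ(A) + χ(C) ≤ χ(B)` for the
truncated Euler characteristics `χ = h⁰ - h¹ ∈ ℤ`. [cite: SerreGAGA1956, n° 16 Lemme 8 (dimension count)] -/
theorem euler_add_euler_le (S : ShortExactSeq dA dB dC)
    [FiniteDimensional K (Cohomology dB 0)] [FiniteDimensional K (Cohomology dC 0)]
    [FiniteDimensional K (Cohomology dA 1)] [FiniteDimensional K (Cohomology dB 1)]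
    [FiniteDimensional K (Cohomology dC 1)] :
    ((finrank K (Cohomology dA 0) : ℤ) - finrank K (Cohomology dA 1)) +
        ((finrank K (Cohomology dC 0) : ℤ) - finrank K (Cohomology dC 1)) ≤
      (finrank K (Cohomology dB 0) : ℤ) - finrank K (Cohomology dB 1) := by
  have h := S.finrank_six_term_le
  omega

end NatCochain.ShortExactSeq

/-! ### The dimension count assembled: towers of restriction sequences -/

namespace NatCochain

variable {K : Type u} [Field K]
  {X : ℕ → ℕ → ℕ → Type w} [∀ j m k, AddCommGroup (X j m k)] [∀ j m k, Module K (X j m k)]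

/-- **Serre's dimension count, abstract form.** Let `F_j(m)` (`j ≤ n` the "dimension of the
support", `m` the twist) be cochain complexes of vector spaces with finite-dimensional `H⁰` and
`H¹`, linked for `j < n` by short exact sequences of complexes
`0 → F_{j+1}(m) → F_{j+1}(m+1) → F_j(m+1) → 0` ("multiplication by the hyperplane equation and
restriction"), and suppose `h¹(F_0(m)) < h⁰(F_0(m))` for all `m` (the bottom level is a non-zero
skyscraper). Then `H⁰(F_n(m)) ≠ 0` for some `m`. (Six-term inequalities
`ShortExactSeq.finrank_six_term_le` fed into `exists_pos_h0_of_euler_inequalities`.)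
[cite: SerreGAGA1956, n° 16 Lemme 8 (dimension count)] -/
theorem exists_finrank_cohomology_zero_pos_of_tower (n : ℕ)
    (d : ∀ j m k, X j m k →ₗ[K] X j m (k + 1))
    (S : ∀ j, j < n → ∀ m, ShortExactSeq (d (j + 1) m) (d (j + 1) (m + 1)) (d j (m + 1)))
    [∀ j m, FiniteDimensional K (Cohomology (d j m) 0)]
    [∀ j m, FiniteDimensional K (Cohomology (d j m) 1)]
    (hbase : ∀ m, finrank K (Cohomology (d 0 m) 1) < finrank K (Cohomology (d 0 m) 0)) :
    ∃ m, 0 < finrank K (Cohomology (d n m) 0) :=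
  exists_pos_h0_of_euler_inequalities n (fun j m ↦ finrank K (Cohomology (d j m) 0))
    (fun j m ↦ finrank K (Cohomology (d j m) 1))
    (fun j hj m ↦ (S j hj m).finrank_six_term_le) hbase

/-- **Serre's dimension count, abstract form, growth**: under the same hypotheses and `n ≥ 1`,
`h⁰(F_n(m))` is unbounded. [cite: SerreGAGA1956, n° 16 Lemme 8 (dimension count)] -/
theorem exists_lt_finrank_cohomology_zero_of_tower {n : ℕ} (hn : 1 ≤ n)
    (d : ∀ j m k, X j m k →ₗ[K] X j m (k + 1))
    (S : ∀ j, j < n → ∀ m, ShortExactSeq (d (j + 1) m) (d (j + 1) (m + 1)) (d j (m + 1)))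
    [∀ j m, FiniteDimensional K (Cohomology (d j m) 0)]
    [∀ j m, FiniteDimensional K (Cohomology (d j m) 1)]
    (hbase : ∀ m, finrank K (Cohomology (d 0 m) 1) < finrank K (Cohomology (d 0 m) 0)) (B : ℕ) :
    ∃ m, B < finrank K (Cohomology (d n m) 0) :=
  exists_lt_h0_of_euler_inequalities hn (fun j m ↦ finrank K (Cohomology (d j m) 0))
    (fun j m ↦ finrank K (Cohomology (d j m) 1))
    (fun j hj m ↦ (S j hj m).finrank_six_term_le) hbase B

end NatCochain

end Literature.Algebra.Homology
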